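import Summits.QuantumFields.YangMills.Theorems.UnitScaleTiltHalvingP6JGaugedBoundAtMember
import Literature.MathematicalPhysics.QuantumFieldTheory.Balaban1983to89.Node00.CarriersB8CubeSub
import HarnessLib

/-!
# Route `UnitScaleTilt`, crux K1 child «MinimiserStabilityRegPr» (stmt-QuantumFields-19200), registered stub `stub_halvingStep` (v10 `BirthV10`) —
# ★★ LINE «H-P6J», FILE (J1b): THE COVERING CUBE MEMBER (obstacle (O2) of LOCATE-PROP6-JUNCTION; ★★OWNER RULING g28-№11 (2)'s preferred, DOOR-NEUTRAL cure) —
# cube-family MONOTONICITY, an ADMISSIBLE covering datum `(M″, ρ″)` AFFINE in `ρ′`, and [B8] Prop. 6 at the covering member with the two divisibility conditions DISCHARGED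

Cell `ym3-torus` (HUMAN RULING D-0037: YM₃ on T³ is ladder rung R3 — NOT d = 4, NOT a mass gap, NOT the Clay problem), width seat `ym-ust-19200-w7` gen 6 (LEAD-H ★w5-19200 g6
23:37:35Z «COVERING LEMMA (O2) — GO»; LOCATE-COVERING-LEMMA 2a9d8770, LOCATE-3 33cc5e9c on 19200).  `--supports stmt-QuantumFields-19200 --as helper`; THEOREMS ONLY (0 `def`, 0 `sorry`);
count-neutral; nothing here claims `hSupUρ4`, the stub, the crux or the gap.

WHY.  lit's crown (✓p678606 `gaugedBoundB8_member_univ`) wants a `CubeB8` datum: `L ≤ ρ ≤ M`, `11d < M`, `L ≤ dM`, and p.98's `L^{s+1} ∣ ρ`, `L^{s+1} ∣ M`; the H lane's member at a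
site `x₀` is `(a, M′, ρ′ := ρ + M + L + S, k := K − n)` with a THIN top cube (`M′ ≥ 1` fixed by the door BEFORE `ρ`) and FAT collars — `ρ′ ≤ M′` fails.  THIS FILE: the cubes
`cube L a M ρ k j` (lit ✓`B8Eq131Cubes` :209; `= InBox (bLo L a k (Lʲ·ρ·gs)) (bHi L a M k (Lʲ·ρ·gs))` by ✓`tlo_bLo`∕✓`thi_bHi`) are MONOTONE in `M` and in `ρ` at fixed corner `a`
(§1 `cube_mono_Mρ`, `tcube_mono_Mρ`, `box_mono_M`); an admissible covering datum exists with `ρ′ ≤ ρ″ ≤ ρ′ + L^{s+1}`, `max(M′, ρ″, 11d+1) ≤ M″ ≤ M′ + ρ′ + 11d + 2L^{s+1}` — AFFINE in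
`ρ′` with L-only slack, which the door's polynomial envelope `B₁(ρ+1)^{qρ}` absorbs (LOCATE-3) (§2 `exists_coveringDatum`); and Prop. 6 holds at the covering member with the
divisibility conditions discharged (§3 `gaugedBoundB8_member_cover`).  WHAT DOES NOT RESTRICT (for (J2), LOCATE 2a9d8770 §2): the support clause (`u = 1` off the BIGGER `□″₀`),
`Restr129`∕`IsLandau138W` on the covering member's towers — (J2) works at `(a, M″, ρ″)` throughout (✓`hSupBlock_of_topRows` accepts `ρ″ ≥ ρ′`, `M″ ≥ M′`); the sizes
(1.136)₁ and the msups restrict to our cubes by §1.  OPEN (scalar, door-adjacent): the torus ROOM for the fatter member (LOCATE 2a9d8770 §3).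

References: T. Bałaban, CMP **99** (1985) 75–102 [Balaban1985RegularSpaces] (p.98 «we take a size of □ equal to ML^jη … M_h = L^s», (1.131) p.99, Prop. 6 p.99).
-/

set_option autoImplicit false

noncomputable section

open NormedSpace

namespace Summit.QuantumFields.YangMills.Theorems.HalvingP6JCoveringMember

open Literature.MathematicalPhysics.QuantumFieldTheory.Balaban1983to89
open B7Prop1Explicit B7Prop2Explicit B7Prop1Local
open B8Ineq130 (tlo thi tlo_apply thi_apply)
open B8Ineq132 (InAk)
open B8Eq131Cubes (bLo bHi gs sqLo sqHi cube box tcube tLo tHi tlo_bLo thi_bHi)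
open B8Eq131CubesAdmissible (cubeFam cubeFam_false_of_le cubeFam_of_lt)
open Node00 (CubeB8 GaugedBoundB8)
open HalvingP6JGaugedBoundAtMember (gaugedBoundB8_member_univ)

variable {d : ℕ} {𝔸 : Type} [CStarAlgebra 𝔸] [Nontrivial 𝔸]

/-! ## §1 Monotonicity of the cube family in `(M, ρ)` at fixed corner `a` -/

/-- The margin boxes `[Lⁿa − m, Lⁿ(a + M) − 1 + m]` grow with `M` and with the margin `m`. [cite: Balaban1985RegularSpaces, p.98, (1.131) p.99] (folklore) -/
theorem inBox_bLo_bHi_mono {L : ℕ} {a : Site d} {M M' n m m' : ℕ} (hM : M ≤ M') (hm : m ≤ m') {x : Site d}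
    (hx : InBox (bLo L a n m) (bHi L a M n m) x) : InBox (bLo L a n m') (bHi L a M' n m') x := by
  intro i
  obtain ⟨h1, h2⟩ := hx i
  simp only [bLo, bHi] at h1 h2 ⊢
  have hm' : (m : ℤ) ≤ m' := by exact_mod_cast hm
  have hM' : (M : ℤ) ≤ M' := by exact_mod_cast hM
  have hL : (0 : ℤ) ≤ (L : ℤ) ^ n := by positivity
  have h3 : (L : ℤ) ^ n * (a i + M) ≤ (L : ℤ) ^ n * (a i + M') := mul_le_mul_of_nonneg_left (by linarith) hL
  constructor <;> linarith

/-- ★ **`cube L a M ρ k j` is monotone in `M` and `ρ`**: a bigger top cube and fatter collars contain the level-`j` cube. [cite: Balaban1985RegularSpaces, (1.131) p.99, p.98] (folklore) -/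
theorem cube_mono_Mρ {L : ℕ} {a : Site d} {M M' ρ ρ' : ℕ} (k j : ℕ) (hM : M ≤ M') (hρ : ρ ≤ ρ') :
    cube L a M ρ k j ⊆ cube L a M' ρ' k j := by
  intro x hx
  simp only [cube, Set.mem_setOf_eq, sqLo, sqHi, tlo_bLo, thi_bHi] at hx ⊢
  exact inBox_bLo_bHi_mono hM (Nat.mul_le_mul_left _ (Nat.mul_le_mul_right _ hρ)) hx

/-- `□ = box L a M k` is monotone in `M`. [cite: Balaban1985RegularSpaces, p.98] (folklore) -/
theorem box_mono_M {L : ℕ} {a : Site d} {M M' : ℕ} (k : ℕ) (hM : M ≤ M') : box L a M k ⊆ box L a M' k := by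
  intro x hx
  simp only [box, Set.mem_setOf_eq] at hx ⊢
  exact inBox_bLo_bHi_mono hM le_rfl hx

/-- `□̃ = tcube L a M ρ k` is monotone in `M` and `ρ`. [cite: Balaban1985RegularSpaces, p.98 («□̃»)] (folklore) -/
theorem tcube_mono_Mρ {L : ℕ} {a : Site d} {M M' ρ ρ' : ℕ} (k : ℕ) (hM : M ≤ M') (hρ : ρ ≤ ρ') :
    tcube L a M ρ k ⊆ tcube L a M' ρ' k := by
  intro x hx
  simp only [tcube, Set.mem_setOf_eq] at hx ⊢
  intro i
  obtain ⟨h1, h2⟩ := hx i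
  simp only [tlo_apply, thi_apply, tLo, tHi] at h1 h2 ⊢
  have hρ' : (ρ : ℤ) ≤ ρ' := by exact_mod_cast hρ
  have hM' : (M : ℤ) ≤ M' := by exact_mod_cast hM
  have hL : (0 : ℤ) ≤ (L : ℤ) ^ k := by positivity
  have h3 : (L : ℤ) ^ k * (a i - 2 * ρ') ≤ (L : ℤ) ^ k * (a i - 2 * ρ) := mul_le_mul_of_nonneg_left (by linarith) hL
  have h4 : (L : ℤ) ^ k * (a i + M - 1 + 2 * ρ + 1) ≤ (L : ℤ) ^ k * (a i + M' - 1 + 2 * ρ' + 1) :=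
    mul_le_mul_of_nonneg_left (by linarith) hL
  constructor <;> linarith

/-! ## §2 An admissible covering datum, affine in `ρ′` -/

/-- ★ **THE COVERING DATUM**: for `1 ≤ d`, `L ≤ ρ′`, a divisor `D ≥ 1` (print: `D = L^{s+1}`), there are `ρ″, M″` with `ρ′ ≤ ρ″ ≤ ρ′ + D`, `M′ ≤ M″`, `ρ″ ≤ M″`, `11d < M″`,
`M″ ≤ M′ + ρ′ + 11d + 2D`, `D ∣ ρ″`, `D ∣ M″`, `L ≤ ρ″`, `L ≤ d·M″` — all affine in `ρ′` with L-only slack. [cite: Balaban1985RegularSpaces, p.98 («M_h = L^s»)] (elementary) -/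
theorem exists_coveringDatum (hd : 1 ≤ d) {L : ℕ} (M' ρ' : ℕ) (hρ : L ≤ ρ') {D : ℕ} (hD : 1 ≤ D) :
    ∃ ρ'' M'' : ℕ, ρ' ≤ ρ'' ∧ ρ'' ≤ ρ' + D ∧ M' ≤ M'' ∧ ρ'' ≤ M'' ∧ 11 * d < M'' ∧ M'' ≤ M' + ρ' + 11 * d + 2 * D ∧
      D ∣ ρ'' ∧ D ∣ M'' ∧ L ≤ ρ'' ∧ L ≤ d * M'' := by
  have h1 := Nat.lt_div_mul_add (a := ρ') hD
  have h2 := Nat.div_mul_le_self ρ' D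
  have h3 := Nat.lt_div_mul_add (a := M' + ρ' + 11 * d + D) hD
  have h4 := Nat.div_mul_le_self (M' + ρ' + 11 * d + D) D
  refine ⟨ρ' / D * D + D, (M' + ρ' + 11 * d + D) / D * D + D, by omega, by omega, by omega, by omega, by omega, by omega,
    ⟨ρ' / D + 1, by ring⟩, ⟨(M' + ρ' + 11 * d + D) / D + 1, by ring⟩, by omega, ?_⟩
  calc L ≤ 1 * ((M' + ρ' + 11 * d + D) / D * D + D) := by omega
    _ ≤ d * ((M' + ρ' + 11 * d + D) / D * D + D) := Nat.mul_le_mul_right _ hd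

/-- The admissible family `{□_j}_{j=0}^{k}` (`cubeFam false`, `Ω₀ := □₀`) is monotone in `M` and `ρ` levelwise. [cite: Balaban1985RegularSpaces, (1.131) p.99] (folklore) -/
theorem cubeFam_false_mono_Mρ {L : ℕ} {a : Site d} {M M' ρ ρ' : ℕ} (k j : ℕ) (hM : M ≤ M') (hρ : ρ ≤ ρ') :
    cubeFam false L a M ρ k j ⊆ cubeFam false L a M' ρ' k j := by
  by_cases hj : j ≤ k
  · rw [cubeFam_false_of_le L a M ρ hj, cubeFam_false_of_le L a M' ρ' hj]; exact cube_mono_Mρ k j hM hρ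
  · rw [cubeFam_of_lt false L a M ρ (not_le.mp hj), cubeFam_of_lt false L a M' ρ' (not_le.mp hj)]

/-- ★★ **THE COVERING CUBE MEMBER** (obstacle (O2)): for `1 ≤ d`, `1 ≤ L ≤ ρ′` and any `M′, k, s`, there is an ADMISSIBLE `CubeB8` datum `(a, M″, ρ″)` at the same corner —
`L ≤ ρ″ ≤ M″`, `11d < M″`, `L ≤ dM″`, p.98's `L^{s+1} ∣ ρ″`, `L^{s+1} ∣ M″` — with `ρ′ ≤ ρ″ ≤ ρ′ + L^{s+1}`, `M′ ≤ M″ ≤ M′ + ρ′ + 11d + 2L^{s+1}` (affine in `ρ′`), whose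
cubes `□″_j ⊇ □_j` (raw and as the admissible family), `□̃″ ⊇ □̃`, `□″ ⊇ □`. [cite: Balaban1985RegularSpaces, p.98 («a size of □ equal to ML^jη, where M is a multiple of R₁M₁»; «M_h = L^s»), (1.131) p.99] -/
theorem exists_coveringCubeB8 (hd : 1 ≤ d) {L : ℕ} (hL : 1 ≤ L) (a : Site d) (M' : ℕ) {ρ' : ℕ} (hρ : L ≤ ρ') (k s : ℕ) :
    ∃ ρ'' M'' : ℕ, ρ' ≤ ρ'' ∧ ρ'' ≤ ρ' + L ^ (s + 1) ∧ M' ≤ M'' ∧ M'' ≤ M' + ρ' + 11 * d + 2 * L ^ (s + 1) ∧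
      L ^ (s + 1) ∣ ρ'' ∧ L ^ (s + 1) ∣ M'' ∧ L ≤ ρ'' ∧ ρ'' ≤ M'' ∧ 11 * d < M'' ∧ L ≤ d * M'' ∧
      (∀ j, cube L a M' ρ' k j ⊆ cube L a M'' ρ'' k j) ∧ (∀ j, cubeFam false L a M' ρ' k j ⊆ cubeFam false L a M'' ρ'' k j) ∧
      tcube L a M' ρ' k ⊆ tcube L a M'' ρ'' k ∧ box L a M' k ⊆ box L a M'' k := by
  have hD : 1 ≤ L ^ (s + 1) := Nat.one_le_pow _ _ (by omega)
  obtain ⟨ρ'', M'', h1, h2, h3, h4, h5, h6, h7, h8, h9, h10⟩ := exists_coveringDatum hd M' ρ' hρ hD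
  exact ⟨ρ'', M'', h1, h2, h3, h6, h7, h8, h9, h4, h5, h10, fun j => cube_mono_Mρ k j h3 h1, fun j => cubeFam_false_mono_Mρ k j h3 h1,
    tcube_mono_Mρ k h3 h1, box_mono_M k h3⟩

/-! ## §3 [B8] Proposition 6 at the covering member, divisibility discharged -/

/-- ★★★ **[B8] PROPOSITION 6 AT THE COVERING CUBE MEMBER, WITH p.98's DIVISIBILITY CONDITIONS DISCHARGED** (LINE H-P6J (J1b)): for `2 ≤ d`, `3 ≤ L` odd, `5 ≤ dL` there are
`1 ≤ B₀`, `0 < c₁`, `ρ₀, M₀, N₀, R₀` such that for every corner `a`, `1 ≤ k`, collar `ρ′ ≥ L`, side `M′` and `s` there is a covering member `(a, M″, ρ″)` (`exists_coveringCubeB8`: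
`ρ′ ≤ ρ″ ≤ ρ′ + L^{s+1}`, `M′ ≤ M″ ≤ M′ + ρ′ + 11d + 2L^{s+1}`, `□″_j ⊇ □_j`, `□̃″ ⊇ □̃`, `□″ ⊇ □`) at which — for every spacing `η > 0`, every `R` with the remaining p.98
conditions READ AT `ρ′` (`3 ≤ L^s`, `M₀ ≤ L^{s+1}`, `R·L^{s+1} ≤ ρ′`, `2L ≤ R`, `R₀ ≤ R`, `N₀ + 1 ≤ R·L^{s+1}`, `ρ₀ ≤ ρ′`), every unitary `U′ ∈ 𝔄_k({ℤᵈ}, α₀)` in the AFFINE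
window `7dL²·(M′ + ρ′ + 11d + 2L^{s+1})·α₀ ≤ c₁` — (1.135)–(1.138) hold (`GaugedBoundB8`) with the affine number `r = 7dL²·(5dLB₀)·(M′ + ρ′ + 11d + 2L^{s+1})·α₀`.
Proof: ✓`gaugedBoundB8_member_univ` at the covering member ∘ lit ✓`GaugedBoundB8.mono`. [cite: Balaban1985RegularSpaces, Prop. 6 (1.135)–(1.138) p.99, p.98] -/
theorem gaugedBoundB8_member_cover (hd2 : 2 ≤ d) {L : ℕ} (hL3 : 3 ≤ L) (hodd : Odd L) (hdL : 5 ≤ d * L) :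
    ∃ B₀ c₁ ρ₀ M₀ : ℝ, ∃ N₀ R₀ : ℕ, 1 ≤ B₀ ∧ 0 < c₁ ∧
      ∀ (a : Site d) {k ρ' : ℕ} (M' : ℕ) (hk : 1 ≤ k) (hLρ : L ≤ ρ') (s : ℕ),
      ∃ (ρ'' M'' : ℕ) (hLρ'' : L ≤ ρ'') (hρM'' : ρ'' ≤ M'') (hbig'' : 11 * d < M'') (hLdM'' : L ≤ d * M''),
        ρ' ≤ ρ'' ∧ ρ'' ≤ ρ' + L ^ (s + 1) ∧ M' ≤ M'' ∧ M'' ≤ M' + ρ' + 11 * d + 2 * L ^ (s + 1) ∧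
        L ^ (s + 1) ∣ ρ'' ∧ L ^ (s + 1) ∣ M'' ∧
        (∀ j, cube L a M' ρ' k j ⊆ cube L a M'' ρ'' k j) ∧ (∀ j, cubeFam false L a M' ρ' k j ⊆ cubeFam false L a M'' ρ'' k j) ∧
        tcube L a M' ρ' k ⊆ tcube L a M'' ρ'' k ∧ box L a M' k ⊆ box L a M'' k ∧
        ∀ (η : ℝ), 0 < η → ∀ (R : ℕ), 3 ≤ L ^ s → M₀ ≤ (L : ℝ) ^ (s + 1) → R * L ^ (s + 1) ≤ ρ' → 2 * L ≤ R →
          R₀ ≤ R → N₀ + 1 ≤ R * L ^ (s + 1) → ρ₀ ≤ (ρ' : ℝ) →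
        ∀ (U' : Site d → Fin d → 𝔸ˣ), (∀ x κ, U' x κ ∈ unitaryUnits 𝔸) → ∀ (α₀ : ℝ), 0 < α₀ →
          InAk L k η α₀ (fun _ => (Set.univ : Set (Site d))) U' →
          7 * d * (L : ℝ) ^ 2 * ((M' + ρ' + 11 * d + 2 * L ^ (s + 1) : ℕ) : ℝ) * α₀ ≤ c₁ →
          GaugedBoundB8 L η U'
            ({ k := k, a := a, M := M'', ρ := ρ'', one_le_k := hk, k_le := le_rfl, L_le_ρ := hLρ'', ρ_le_M := hρM'', big := hbig'', L_le_dM := hLdM'',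
               box_sub := Set.subset_univ _, tcube_sub := Set.subset_univ _ } :
              CubeB8 d L k (fun _ => (Set.univ : Set (Site d))))
            (7 * d * (L : ℝ) ^ 2 * (5 * (d : ℝ) * L * B₀) * ((M' + ρ' + 11 * d + 2 * L ^ (s + 1) : ℕ) : ℝ) * α₀) := by
  obtain ⟨B₀, c₁, ρ₀, M₀, N₀, R₀, hB₀, hc₁, h⟩ := gaugedBoundB8_member_univ (𝔸 := 𝔸) hd2 hL3 hodd hdL
  refine ⟨B₀, c₁, ρ₀, M₀, N₀, R₀, hB₀, hc₁, ?_⟩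
  intro a k ρ' M' hk hLρ s
  obtain ⟨ρ'', M'', h1, h2, h3, h4, h5, h6, h7, h8, h9, h10, hc, hcf, ht, hb⟩ :=
    exists_coveringCubeB8 (by omega) (by omega) a M' hLρ k s
  refine ⟨ρ'', M'', h7, h8, h9, h10, h1, h2, h3, h4, h5, h6, hc, hcf, ht, hb, ?_⟩
  intro η hη R h3s hM₀ hRρ h2R hR₀ hN₀ hρ₀ U' hU' α₀ hα₀ hInAk hwin
  have hB₀0 : 0 ≤ B₀ := by linarith
  have hcast : (M'' : ℝ) ≤ ((M' + ρ' + 11 * d + 2 * L ^ (s + 1) : ℕ) : ℝ) := by exact_mod_cast h4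
  have hρcast : (ρ' : ℝ) ≤ ρ'' := by exact_mod_cast h1
  have hwin'' : 7 * d * (L : ℝ) ^ 2 * M'' * α₀ ≤ c₁ :=
    le_trans (mul_le_mul_of_nonneg_right (mul_le_mul_of_nonneg_left hcast (by positivity)) hα₀.le) hwin
  have hG := h η hη a hk h7 h8 h9 h10 s R h3s hM₀ h5 h6 (hRρ.trans h1) h2R hR₀ hN₀ (hρ₀.trans hρcast) U' hU' α₀ hα₀ hInAk hwin''
  exact GaugedBoundB8.mono hη.le (mul_le_mul_of_nonneg_right (mul_le_mul_of_nonneg_left hcast (by positivity)) hα₀.le) hG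

end Summit.QuantumFields.YangMills.Theorems.HalvingP6JCoveringMember

end
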